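import Summits.FinalStateConjecture.FinalStateConjecture.Theorems.EIHFluxBalanceInertialRecessionRechartClockTransferHole
import Summits.FinalStateConjecture.FinalStateConjecture.Theorems.EIHFluxBalanceInertialRecessionRechartClockCoverage
import Summits.FinalStateConjecture.FinalStateConjecture.Theorems.EIHFluxBalanceInertialRecessionRechartClockBallProfile

/-!
# Route EIHFluxBalance — `InertialRecession`, re-charting: the PROFILE-DEPENDENT HYPOTHESES of the
# transfer …RechartTransfer3 for the clock charts of `N` holes

Helper file for the crux `stmt-FinalStateConjecture-10166`
(`Summit.FinalStateConjecture.FinalStateConjecture.Theses.EIHFluxBalance.InertialRecession`),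
stub `stub_rechart` (the transfer P2 of line `sublinear-is-free-clean-window-charges`), part G2.

`clock_transfer_clauses`: for the final (boosted by `Λfᵢ`, lagged by `s₀ᵢ`) charts `ψᵢ` of the `N`
holes — built from the clock-chart packages (`Aᵢ = honestChart Λ̃ᵢ ξᵢ T₀ᵢ ∘ Cᵢ`, their clauses), the
lab clocks `θᵢ` with `slackᵢ + s₀ᵢ ≥ 1`, and the rest-frame certified Carter reach with profile `Rrᵢ`
(…RechartCarterReachClock) — this file produces the ball profile `Rb`, the dictionary tilts `βᵢ`, the
thresholds `Tc ≤ τm`, `S`, `T₂`, and proves the hypotheses `hcov`, `hlab`, `hstat`, `hT₂`, `hmesh`,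
`hzone`, `hRz` of `exterior_subset_certified_union_causalPast₃` VERBATIM for
`Kb i = boostedKerrBackground (Λf i) (s₀ i • Λf i e₀) (M i) (a i)`, `rH = r₊`, `δ = 1`, `Rz = r₊ + 2`,
clock `θᵢ − s₀ᵢ`, reach profile `Rrᵢ(· + s₀ᵢ)`. Inputs: …RechartClockCoverage (dictionaries),
…RechartTiltEnvelope (tilt envelope, slack dichotomy), …RechartClockBallProfile (`Rb`),
…RechartClockTransferHole (pointwise transports). [folklore]
-/

noncomputable section

set_option linter.dupNamespace false

open Set Filter Topology Function TopologicalSpace Literature.Geometry.Lorentzian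
open Summit.FinalStateConjecture.FinalStateConjecture.Theorems.SublinearIsFree.Rechart
open scoped Manifold ContDiff ENNReal BigOperators

namespace Summit.FinalStateConjecture.FinalStateConjecture.Theorems

/-- Subextremal bookkeeping: `0 ≤ |a| < M ≤ r₊`, so `0 < r₊` and `1 ≤ 1 + |a|/r₊ ≤ 2`. [folklore] -/
theorem rPlus_facts {M a : ℝ} (h : Kerr.IsSubextremal M a) :
    0 < Kerr.rPlus M a ∧ |a| ≤ Kerr.rPlus M a ∧ 1 ≤ 1 + |a| / Kerr.rPlus M a ∧
      1 + |a| / Kerr.rPlus M a ≤ 2 := by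
  have hMr : M ≤ Kerr.rPlus M a := by
    unfold Kerr.rPlus; linarith [Real.sqrt_nonneg (M ^ 2 - a ^ 2)]
  have ha : |a| < M := h
  have hr : 0 < Kerr.rPlus M a := (abs_nonneg a).trans_lt (ha.trans_le hMr)
  have har : |a| ≤ Kerr.rPlus M a := ha.le.trans hMr
  refine ⟨hr, har, by have := div_nonneg (abs_nonneg a) hr.le; linarith, ?_⟩
  have : |a| / Kerr.rPlus M a ≤ 1 := (div_le_one hr).mpr har
  linarith

section Clauses

variable {𝓢 : Spacetime 4} {N : ℕ} (M a : Fin N → ℝ) (hsub : ∀ i, Kerr.IsSubextremal (M i) (a i))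
  (Λp Λt : Fin N → ℝ → lorentzGroup) (ξ : Fin N → ℝ → E3) (T₀ : Fin N → ℝ → ℝ) (A C : Fin N → E4 → E4)
  (U : Opens E4) (Φ : U → 𝓢.carrier) (hAU : ∀ i, ∀ z ∈ boostedKerrExterior 1 0 (M i) (a i), A i z ∈ U)
  (Λf : Fin N → lorentzGroup) (s₀ : Fin N → ℝ)
  (ψ : ∀ i, boostedKerrExterior (Λf i) (s₀ i • (Λf i : E4 ≃L[ℝ] E4) (E4.basisVector 0)) (M i) (a i) →
    𝓢.carrier)
  (hψ : ∀ i y, ψ i y = Φ ⟨A i ((Λf i : E4 ≃L[ℝ] E4).symm y.1),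
    hAU i _ (symm_mem_rest_of_mem_lag (Λf i) (s₀ i) (M i) (a i) y.2)⟩)
  {γ τ₀ : ℝ} (hγ1 : 1 ≤ γ)
  (hrad : ∀ i t x, Kerr.radius (a i) (poincareInv (Λt i t) (E4.ofTimeSpace t (ξ i t)) x) =
    Kerr.radius (a i) (poincareInv (Λp i t) (E4.ofTimeSpace t (ξ i t)) x))
  (hΛt : ∀ i, ContDiff ℝ ∞ (fun t ↦ ((Λt i t : E4 ≃L[ℝ] E4) : E4 →L[ℝ] E4)))
  (huγ : ∀ i t, |((Λt i t : E4 ≃L[ℝ] E4) (E4.basisVector 0)) 0| ≤ γ)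
  (hpos : ∀ i t, 0 < ((Λt i t : E4 ≃L[ℝ] E4) (E4.basisVector 0)) 0)
  (hdec : ∀ i m, 1 ≤ m → m ≤ 3 → Tendsto (fun t ↦ iteratedDeriv m
    (fun s ↦ ((Λt i s : E4 ≃L[ℝ] E4) : E4 →L[ℝ] E4)) t) atTop (𝓝 0))
  (hT₀ : ∀ i, ContDiff ℝ ∞ (T₀ i)) (hT₀lo : ∀ i σ τ, σ ≤ τ → τ - σ ≤ T₀ i τ - T₀ i σ)
  (hhon : ∀ i (K : ℝ), ∃ τK : ℝ, ∀ y : E4, τK ≤ y 0 → ‖E4.spatial y‖ ≤ K →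
    A i =ᶠ[𝓝 y] honestChart (Λt i) (ξ i) (T₀ i))
  (hAinj : ∀ i, Injective (A i)) (hAC : ∀ i y, A i y = honestChart (Λt i) (ξ i) (T₀ i) (C i y))
  (hCle : ∀ i y, ‖E4.spatial (C i y)‖ ≤ ‖E4.spatial y‖) (hAlate : ∀ i z, τ₀ < A i z 0)
  (hinj : ∀ x x' : U, τ₀ < x.1 0 → τ₀ < x'.1 0 → Φ x = Φ x' → x = x')
  (θ : Fin N → ℝ → ℝ) (hθT : ∀ i τ, θ i (T₀ i τ) = τ)
  (hθm : ∀ i, Monotone (θ i)) (hθ1 : ∀ i t t', t' ≤ t → θ i t - θ i t' ≤ t - t')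
  (hθtop : ∀ i, Tendsto (θ i) atTop atTop)
  (hslack : ∀ i t, HasDerivAt (fun t ↦ t - θ i t)
    (1 - (((Λt i t : E4 ≃L[ℝ] E4) (E4.basisVector 0)) 0)⁻¹) t)
  {Ts : ℝ} (hs₀ : ∀ i t, Ts ≤ t → 1 ≤ (t - θ i t) + s₀ i)
  (Rr : Fin N → ℝ → ℝ) (hRrm : ∀ i, Monotone (Rr i)) (hRrtop : ∀ i, Tendsto (Rr i) atTop atTop)
  (Sr : Fin N → ℝ)
  (hreach : ∀ i (z : boostedKerrExterior 1 0 (M i) (a i)) (τ₁ : ℝ), Sr i ≤ z.1 0 → z.1 0 ≤ τ₁ →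
    Kerr.rPlus (M i) (a i) + 1 ≤ Kerr.radius (a i) z.1 → Kerr.radius (a i) z.1 ≤ Rr i (z.1 0) →
    Φ ⟨A i z.1, hAU i z.1 z.2⟩ ∈ 𝓢.metric.causalPast 𝓢.timeOrientation
      ((fun z : boostedKerrExterior 1 0 (M i) (a i) ↦ Φ ⟨A i z.1, hAU i z.1 z.2⟩) ''
        (boostedKerrBackground 1 0 (M i) (a i)).truncTimeSlab (Rr i τ₁) τ₁))

include hsub hψ hγ1 hrad hΛt huγ hpos hdec hT₀ hT₀lo hhon hAinj hAC hCle hAlate hinj hθT hθm hθ1 hθtop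
  hslack hs₀ hRrm hRrtop hreach in
-- long statement and bookkeeping proof
set_option maxHeartbeats 1600000 in
/-- **The profile-dependent hypotheses of the transfer for the clock charts.** See the module
docstring. [folklore] -/
theorem clock_transfer_clauses :
    ∃ (Rb : ℝ → ℝ) (β : Fin N → ℝ → ℝ) (Tc S τm : ℝ) (T₂ : ℝ → ℝ),
      Monotone Rb ∧ Tendsto Rb atTop atTop ∧ (∀ t, 0 ≤ Rb t) ∧
      Tendsto (fun t ↦ Rb t / t) atTop (𝓝 0) ∧ (∀ i t, 0 ≤ β i t) ∧ τ₀ < Tc ∧ Tc ≤ τm ∧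
      -- hcov
      (∀ (i : Fin N) (x : U), Tc ≤ x.1 0 →
        Kerr.rPlus (M i) (a i) <
          Kerr.radius (a i) (poincareInv (Λp i (x.1 0)) (E4.ofTimeSpace (x.1 0) (ξ i (x.1 0))) x.1) →
        Kerr.radius (a i) (poincareInv (Λp i (x.1 0)) (E4.ofTimeSpace (x.1 0) (ξ i (x.1 0))) x.1) ≤
          Rb (x.1 0) →
        ∃ y : (boostedKerrBackground (Λf i) (s₀ i • (Λf i : E4 ≃L[ℝ] E4) (E4.basisVector 0)) (M i)
          (a i)).domain, ψ i y = Φ x ∧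
          (boostedKerrBackground (Λf i) (s₀ i • (Λf i : E4 ≃L[ℝ] E4) (E4.basisVector 0)) (M i)
            (a i)).radius y.1 =
            Kerr.radius (a i) (poincareInv (Λp i (x.1 0)) (E4.ofTimeSpace (x.1 0) (ξ i (x.1 0))) x.1) ∧
          |(boostedKerrBackground (Λf i) (s₀ i • (Λf i : E4 ≃L[ℝ] E4) (E4.basisVector 0)) (M i)
            (a i)).time y.1 - (θ i (x.1 0) - s₀ i)| ≤ β i (x.1 0) *
            Kerr.radius (a i) (poincareInv (Λp i (x.1 0)) (E4.ofTimeSpace (x.1 0) (ξ i (x.1 0))) x.1)) ∧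
      -- hT₂
      (∀ (i : Fin N) (τ₁ : ℝ), (∀ t, T₂ τ₁ ≤ t →
        τ₁ + β i t * (Kerr.rPlus (M i) (a i) + 2) ≤ θ i t - s₀ i) ∧ τ₁ ≤ T₂ τ₁) ∧
      -- hmesh
      (∀ (i : Fin N) (t : ℝ), τm ≤ t → S ≤ θ i t - s₀ i - β i t * Rb t ∧
        Rb t ≤ Rr i (θ i t - s₀ i - β i t * Rb t + s₀ i) ∧ θ i t - s₀ i + β i t * Rb t ≤ t) ∧
      -- hzone
      (∀ (i : Fin N) (t : ℝ), τm ≤ t → S ≤ θ i t - s₀ i - β i t * (Kerr.rPlus (M i) (a i) + 2) ∧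
        Kerr.rPlus (M i) (a i) + 2 ≤ Rr i (θ i t - s₀ i - β i t * (Kerr.rPlus (M i) (a i) + 2) + s₀ i) ∧
        Kerr.rPlus (M i) (a i) + 2 ≤ Rr i (t + s₀ i)) ∧
      -- hRz
      (∀ (i : Fin N) (t : ℝ), τm ≤ t → Kerr.rPlus (M i) (a i) + 2 ≤ Rb t) ∧
      -- hlab
      (∀ (i : Fin N) (y : (boostedKerrBackground (Λf i) (s₀ i • (Λf i : E4 ≃L[ℝ] E4) (E4.basisVector 0))
        (M i) (a i)).domain) (x : U), Φ x = ψ i y → Tc ≤ x.1 0 →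
        (boostedKerrBackground (Λf i) (s₀ i • (Λf i : E4 ≃L[ℝ] E4) (E4.basisVector 0)) (M i)
          (a i)).radius y.1 < Kerr.rPlus (M i) (a i) + 2 →
        Kerr.radius (a i) (poincareInv (Λp i (x.1 0)) (E4.ofTimeSpace (x.1 0) (ξ i (x.1 0))) x.1) =
          (boostedKerrBackground (Λf i) (s₀ i • (Λf i : E4 ≃L[ℝ] E4) (E4.basisVector 0)) (M i)
            (a i)).radius y.1) ∧
      -- hstat
      (∀ (i : Fin N) (y : (boostedKerrBackground (Λf i) (s₀ i • (Λf i : E4 ≃L[ℝ] E4) (E4.basisVector 0))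
        (M i) (a i)).domain) (τ₁ : ℝ), τm ≤ τ₁ →
        S ≤ (boostedKerrBackground (Λf i) (s₀ i • (Λf i : E4 ≃L[ℝ] E4) (E4.basisVector 0)) (M i)
          (a i)).time y.1 →
        (boostedKerrBackground (Λf i) (s₀ i • (Λf i : E4 ≃L[ℝ] E4) (E4.basisVector 0)) (M i)
          (a i)).time y.1 ≤ τ₁ →
        Kerr.rPlus (M i) (a i) + 1 ≤ (boostedKerrBackground (Λf i)
          (s₀ i • (Λf i : E4 ≃L[ℝ] E4) (E4.basisVector 0)) (M i) (a i)).radius y.1 →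
        (boostedKerrBackground (Λf i) (s₀ i • (Λf i : E4 ≃L[ℝ] E4) (E4.basisVector 0)) (M i)
          (a i)).radius y.1 ≤ Rr i ((boostedKerrBackground (Λf i)
            (s₀ i • (Λf i : E4 ≃L[ℝ] E4) (E4.basisVector 0)) (M i) (a i)).time y.1 + s₀ i) →
        ψ i y ∈ 𝓢.metric.causalPast 𝓢.timeOrientation (ψ i ''
          (boostedKerrBackground (Λf i) (s₀ i • (Λf i : E4 ≃L[ℝ] E4) (E4.basisVector 0)) (M i)
            (a i)).truncTimeSlab (Rr i (τ₁ + s₀ i)) τ₁)) := by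
  have hγ0 : 0 ≤ γ := zero_le_one.trans hγ1
  -- per-hole constants
  have hrp : ∀ i, 0 < Kerr.rPlus (M i) (a i) ∧ |a i| ≤ Kerr.rPlus (M i) (a i) ∧
      1 ≤ 1 + |a i| / Kerr.rPlus (M i) (a i) ∧ 1 + |a i| / Kerr.rPlus (M i) (a i) ≤ 2 :=
    fun i ↦ rPlus_facts (hsub i)
  set c : Fin N → ℝ := fun i ↦ 1 + |a i| / Kerr.rPlus (M i) (a i) with hc
  set Rz : Fin N → ℝ := fun i ↦ Kerr.rPlus (M i) (a i) + 2 with hRz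
  have hRz0 : ∀ i, 0 ≤ Rz i := fun i ↦ by rw [hRz]; linarith [(hrp i).1]
  -- the Lorentz factors
  have hu := fun i ↦ frameVel_zero_facts (Λt i) (hΛt i) (huγ i) (hpos i) (hdec i)
  choose T₁ hT₁ using fun i ↦ (hu i).2.2.2
  -- tilt envelopes
  choose βe hβe using fun i ↦ exists_tilt_envelope (u := fun t ↦ ((Λt i t : E4 ≃L[ℝ] E4)
    (E4.basisVector 0)) 0) (hu i).1 (hu i).2.1
  set β : Fin N → ℝ → ℝ := fun i t ↦ βe i t * c i with hβ
  have hβ0 : ∀ i t, 0 ≤ β i t := fun i t ↦ mul_nonneg ((hβe i).2.1 t) (zero_le_one.trans (hrp i).2.2.1)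
  have hβB : ∀ i t, β i t ≤ 2 * γ := fun i t ↦ by
    rw [hβ]
    calc βe i t * c i ≤ γ * 2 :=
          mul_le_mul ((hβe i).2.2.1 t) (hrp i).2.2.2 (zero_le_one.trans (hrp i).2.2.1) hγ0
      _ = 2 * γ := by ring
  -- slack dichotomy for the dictionary tilt
  have hev : ∀ i (n : ℕ), ∀ᶠ t in atTop, β i t * n ≤ (t - θ i t) + s₀ i := by
    intro i n
    have h := eventually_tilt_mul_le_slack (β := βe i) (hu i).1 (hu i).2.1 one_pos (hT₁ i) (hslack i)
      (hβe i).2.2.1 (hβe i).2.2.2.2 (hs₀ i) (n := c i * n)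
      (mul_nonneg (zero_le_one.trans (hrp i).2.2.1) (Nat.cast_nonneg n))
    refine h.mono fun t ht ↦ ?_
    rw [hβ]; simp only; rw [mul_assoc]; exact ht
  -- coverage and lab thresholds
  choose tcov htcov using fun i (n : ℕ) ↦ coverage_dictionary (Λt i) (ξ i) (T₀ i) (hΛt i) (hT₀ i) hγ1
    (huγ i) (hT₀lo i) (a i) (hhon i) (hθT i) (hθm i) (hθ1 i) (n : ℝ)
  choose tlab htlab using fun i ↦ lab_dictionary (Λt i) (ξ i) (T₀ i) (hΛt i) (hT₀ i) hγ1 (huγ i)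
    (hT₀lo i) (a i) (hhon i) (hAinj i) (hAC i) (hCle i) (Rz i + |a i|)
  -- the floor and the ball profile
  set S : ℝ := ∑ i, |Sr i - s₀ i| with hS
  have hSle : ∀ i, Sr i - s₀ i ≤ S := fun i ↦ by
    rw [hS]
    have h := Finset.single_le_sum (f := fun i ↦ |Sr i - s₀ i|) (fun i _ ↦ abs_nonneg _)
      (Finset.mem_univ i)
    exact (le_abs_self _).trans h
  obtain ⟨Rn, hRm, hRtop, hRdiv, T, hT⟩ := exists_ball_profile θ β Rr s₀ (fun _ ↦ 2 * γ) (fun _ ↦ γ)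
    (fun i ↦ γ * |a i|) tcov S hθtop hβ0 (fun _ ↦ by positivity) (fun _ ↦ hγ0) hev hRrm hRrtop
  set Rb : ℝ → ℝ := fun t ↦ (Rn t : ℝ) with hRb
  -- zone thresholds
  have hρ₀ : ∀ i, ∃ ρ₀ : ℝ, ∀ ρ, ρ₀ ≤ ρ → Rz i ≤ Rr i ρ := fun i ↦
    eventually_atTop.mp ((hRrtop i).eventually (eventually_ge_atTop _))
  choose ρ₀ hρ₀ using hρ₀
  obtain ⟨tz, htz⟩ : ∃ tz : ℝ, ∀ t, tz ≤ t → ∑ i, Rz i ≤ Rb t :=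
    eventually_atTop.mp (hRtop.eventually (eventually_ge_atTop _))
  have hRzsum : ∀ i, Rz i ≤ ∑ j, Rz j := fun i ↦
    Finset.single_le_sum (f := Rz) (fun j _ ↦ hRz0 j) (Finset.mem_univ i)
  set Tc : ℝ := max (max T (τ₀ + 1)) (∑ i, |tlab i|) with hTc
  set τm : ℝ := max Tc (max tz (∑ i, (|T₀ i (S + s₀ i + 2 * γ * Rz i)| +
    |T₀ i (ρ₀ i + 2 * γ * Rz i)| + |ρ₀ i - s₀ i|))) with hτm
  set T₂ : ℝ → ℝ := fun τ₁ ↦ max τ₁ (∑ i, |T₀ i (τ₁ + s₀ i + 2 * γ * Rz i)|) with hT₂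
  have hTcT : T ≤ Tc := (le_max_left _ _).trans (le_max_left _ _)
  have hTc0 : τ₀ < Tc := (lt_add_one τ₀).trans_le ((le_max_right _ _).trans (le_max_left _ _))
  have hTclab : ∀ i, tlab i ≤ Tc := fun i ↦ by
    have h := Finset.single_le_sum (f := fun i ↦ |tlab i|) (fun i _ ↦ abs_nonneg _) (Finset.mem_univ i)
    exact ((le_abs_self _).trans h).trans (le_max_right _ _)
  have hτmTc : Tc ≤ τm := le_max_left _ _
  have hτmz : tz ≤ τm := (le_max_left _ _).trans (le_max_right _ _)
  have hτmi : ∀ i, T₀ i (S + s₀ i + 2 * γ * Rz i) ≤ τm ∧ T₀ i (ρ₀ i + 2 * γ * Rz i) ≤ τm ∧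
      ρ₀ i - s₀ i ≤ τm := by
    intro i
    have h := Finset.single_le_sum (f := fun i ↦ |T₀ i (S + s₀ i + 2 * γ * Rz i)| +
      |T₀ i (ρ₀ i + 2 * γ * Rz i)| + |ρ₀ i - s₀ i|) (fun i _ ↦ by positivity) (Finset.mem_univ i)
    have h' : (∑ i, (|T₀ i (S + s₀ i + 2 * γ * Rz i)| + |T₀ i (ρ₀ i + 2 * γ * Rz i)| + |ρ₀ i - s₀ i|)) ≤ τm :=
      (le_max_right _ _).trans (le_max_right _ _)
    have hle : |T₀ i (S + s₀ i + 2 * γ * Rz i)| + |T₀ i (ρ₀ i + 2 * γ * Rz i)| + |ρ₀ i - s₀ i| ≤ τm :=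
      h.trans h'
    have h1 := le_abs_self (T₀ i (S + s₀ i + 2 * γ * Rz i))
    have h2 := le_abs_self (T₀ i (ρ₀ i + 2 * γ * Rz i))
    have h3 := le_abs_self (ρ₀ i - s₀ i)
    have h4 := abs_nonneg (T₀ i (S + s₀ i + 2 * γ * Rz i))
    have h5 := abs_nonneg (T₀ i (ρ₀ i + 2 * γ * Rz i))
    have h6 := abs_nonneg (ρ₀ i - s₀ i)
    exact ⟨by linarith, by linarith, by linarith⟩
  -- `θᵢ t ≥ c` once `t ≥ T₀ᵢ c`
  have hθge : ∀ i (cc t : ℝ), T₀ i cc ≤ t → cc ≤ θ i t := fun i cc t h ↦ by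
    rw [← hθT i cc]; exact hθm i h
  refine ⟨Rb, β, Tc, S, τm, T₂, fun t t' h ↦ by show ((Rn t : ℕ) : ℝ) ≤ Rn t'; exact_mod_cast hRm h, hRtop,
    fun t ↦ Nat.cast_nonneg _, hRdiv, hβ0, hTc0, hτmTc, ?_, ?_, ?_, ?_, ?_, ?_, ?_⟩
  · -- hcov
    intro i x hxT hrx hxR
    obtain ⟨-, hall⟩ := hT (x.1 0) (hTcT.trans hxT)
    obtain ⟨hcovt, -, hwin, -, -⟩ := hall i
    have hxR' : Kerr.radius (a i) (poincareInv (Λt i (x.1 0)) (E4.ofTimeSpace (x.1 0) (ξ i (x.1 0))) x.1) ≤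
        Rn (x.1 0) := by rw [hrad]; exact hxR
    obtain ⟨z, hAz, hrz, htime, hwinz⟩ := htcov i (Rn (x.1 0)) x.1 hcovt hxR'
    rw [hrad] at hrz
    -- `z` is in the exterior
    have hrz' : Kerr.rPlus (M i) (a i) < Kerr.radius (a i) z := by rw [hrz]; exact hrx
    have hz : z ∈ boostedKerrExterior 1 0 (M i) (a i) := by
      rw [mem_boostedKerrExterior, Literature.Geometry.Lorentzian.poincareInv_one_zero, Kerr.mem_exterior]
      exact max_lt hrz' ((hrp i).1.trans hrz')
    -- the window: `T₀ z⁰ ≥ x⁰/2`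
    have hz0 : x.1 0 / 2 ≤ T₀ i (z 0) := by
      have h1 := (abs_le.mp hwinz).1
      have h2 : γ * (Kerr.radius (a i) z + |a i|) ≤ γ * (Rn (x.1 0) + |a i|) :=
        mul_le_mul_of_nonneg_left (by linarith [hrz.le.trans_eq rfl, hxR]) hγ0
      simp only at hwin
      linarith
    have htilt := (hβe i).2.2.2.1 (x.1 0) (T₀ i (z 0)) hz0
    have hoff : Kerr.radius (a i) z + |a i| ≤ c i * Kerr.radius (a i) z := by
      rw [hc]; simp only
      rw [add_mul, one_mul, div_mul_eq_mul_div, add_le_add_iff_left, le_div_iff₀ (hrp i).1]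
      exact mul_le_mul_of_nonneg_left hrz'.le (abs_nonneg _)
    have htime' : |z 0 - θ i (x.1 0)| ≤ β i (x.1 0) * Kerr.radius (a i) z := by
      refine htime.trans ?_
      rw [hβ]; simp only
      calc Real.sqrt ((((Λt i (T₀ i (z 0)) : E4 ≃L[ℝ] E4) (E4.basisVector 0)) 0) ^ 2 - 1) *
            (Kerr.radius (a i) z + |a i|)
          ≤ βe i (x.1 0) * (c i * Kerr.radius (a i) z) :=
            mul_le_mul htilt hoff (add_nonneg (Kerr.radius_nonneg _ _) (abs_nonneg _)) ((hβe i).2.1 _)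
        _ = βe i (x.1 0) * c i * Kerr.radius (a i) z := by ring
    obtain ⟨y, hyψ, hyr, hyt⟩ := cov_transport (Λf i) (s₀ i) (M i) (a i) U Φ (A i) (hAU i) (ψ i) (hψ i)
      hAz hz htime'
    exact ⟨y, hyψ, hyr.trans hrz, by rw [← hrz]; exact hyt⟩
  · -- hT₂
    intro i τ₁
    refine ⟨fun t ht ↦ ?_, le_max_left _ _⟩
    have h1 : T₀ i (τ₁ + s₀ i + 2 * γ * Rz i) ≤ t := by
      have h := Finset.single_le_sum (f := fun i ↦ |T₀ i (τ₁ + s₀ i + 2 * γ * Rz i)|)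
        (fun i _ ↦ abs_nonneg _) (Finset.mem_univ i)
      exact ((le_abs_self _).trans h).trans ((le_max_right _ _).trans ht)
    have h2 := hθge i _ t h1
    have h3 : β i t * Rz i ≤ 2 * γ * Rz i := mul_le_mul_of_nonneg_right (hβB i t) (hRz0 i)
    show τ₁ + β i t * (Kerr.rPlus (M i) (a i) + 2) ≤ θ i t - s₀ i
    linarith
  · -- hmesh
    intro i t ht
    obtain ⟨-, hall⟩ := hT t (hTcT.trans (hτmTc.trans ht))
    obtain ⟨-, hs, -, hSi, hR⟩ := hall i
    have h3 : β i t * (Rn t : ℝ) ≤ 2 * γ * Rn t := mul_le_mul_of_nonneg_right (hβB i t) (Nat.cast_nonneg _)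
    refine ⟨?_, ?_, ?_⟩
    · show S ≤ θ i t - s₀ i - β i t * (Rn t : ℝ); linarith
    · show (Rn t : ℝ) ≤ Rr i (θ i t - s₀ i - β i t * (Rn t : ℝ) + s₀ i)
      exact hR.trans (hRrm i (by linarith))
    · show θ i t - s₀ i + β i t * (Rn t : ℝ) ≤ t; linarith
  · -- hzone
    intro i t ht
    obtain ⟨h1, h2, h3⟩ := hτmi i
    have hθ1' := hθge i _ t (h1.trans ht)
    have hθ2' := hθge i _ t (h2.trans ht)
    have h4 : β i t * Rz i ≤ 2 * γ * Rz i := mul_le_mul_of_nonneg_right (hβB i t) (hRz0 i)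
    refine ⟨by linarith, (hρ₀ i _ le_rfl).trans (hRrm i (by linarith)), hρ₀ i _ (by linarith)⟩
  · -- hRz
    intro i t ht
    exact (hRzsum i).trans (htz t (hτmz.trans ht))
  · -- hlab
    intro i y x hxy hxT hyr
    have hdict : ∀ z : E4, tlab i ≤ A i z 0 → ‖E4.spatial z‖ ≤ Rz i + |a i| → ∀ h : A i z ∈ U,
        Kerr.radius (a i) (poincareInv (Λp i ((⟨A i z, h⟩ : U).1 0))
          (E4.ofTimeSpace ((⟨A i z, h⟩ : U).1 0) (ξ i ((⟨A i z, h⟩ : U).1 0))) (⟨A i z, h⟩ : U).1) =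
          Kerr.radius (a i) z := by
      intro z hz hzK _
      rw [← hrad]
      exact ((htlab i z hz hzK).2).symm
    refine lab_transport (Λf i) (s₀ i) (M i) (a i) U Φ (A i) (hAU i) (ψ i) (hψ i) hinj (hAlate i)
      (rp := fun x : U ↦ Kerr.radius (a i) (poincareInv (Λp i (x.1 0)) (E4.ofTimeSpace (x.1 0) (ξ i (x.1 0))) x.1))
      hdict y x hxy (hTc0.trans_le hxT) ((hTclab i).trans hxT) ?_
    rw [lag_radius] at hyr
    exact (spatialNorm_le_radius_add_abs (a i) _).trans (by linarith)
  · -- hstat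
    intro i y τ₁ _ hyS hyt hr1 hr2
    refine stat_transport (Λf i) (s₀ i) (M i) (a i) U Φ (A i) (hAU i) (ψ i) (hψ i) (Rr i) (S' := Sr i)
      (δ := 1) (fun z h1 h2 h3 h4 ↦ hreach i z (τ₁ + s₀ i) h1 h2 h3 h4) y ?_ hyt hr1 hr2
    linarith [hSle i]

end Clauses

/-- Registered one-line form (stub `rPlus_facts_rechart` of the crux item) of `rPlus_facts`. [folklore] -/
theorem rPlus_facts_rechart : open Literature.Geometry.Lorentzian in ∀ {M a : ℝ}, Kerr.IsSubextremal M a → 0 < Kerr.rPlus M a ∧ |a| ≤ Kerr.rPlus M a ∧ 1 ≤ 1 + |a| / Kerr.rPlus M a ∧ 1 + |a| / Kerr.rPlus M a ≤ 2 :=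
  fun h ↦ rPlus_facts h

end Summit.FinalStateConjecture.FinalStateConjecture.Theorems
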